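import Summits.BirchSwinnertonDyer.BirchSwinnertonDyer.Theorems.InertBadSignedBranchesInertBadAtThreeNonNullOddHeegner
import HarnessLib

set_option linter.dupNamespace false -- `Summit.BirchSwinnertonDyer.BirchSwinnertonDyer.Theorems.…` (summit = sub, D-0017)
set_option autoImplicit false

/-!
# C⁺(N,p) from a FIRST-MOMENT bound: the supply non-nullity of line `size_tail` (crux
# `HeegnerTwistCouplingInSupply`, stmt-BirchSwinnertonDyer-21381) follows from any bounded average of a
# `p`-divisibility statistic over the odd Heegner family, with bound `< p`

Crux `HeegnerTwistCouplingInSupply` (stmt-21381, route `BiquadraticEisensteinDescent` r5), line `size_tail` v4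
(lead `bsd-line-ibd-p1`), registered open stub `stub_nonNullIndivisibleHeegner` = C⁺(N,p): «for `N ≠ 0`, `p ≥ 5`, the
discriminants of imaginary quadratic `K` with `|d_K| > 4`, every `ℓ ∣ N` split and `p ∤ h_K` are not a
`twistDensity`-null set» (the hypothesis `hC` of the landed density-one glue p610230 / p612428). THEOREMS ONLY (no
definition, no named fact, no `sorry`). This file does NOT prove C⁺; it proves the BRIDGE that reduces it to a moment
statement of Cohen–Lenstra type, W-free and L-free:

* `not_twistDensity_zero_of_frequently_moment_le` — let `t : ℤ → ℕ` be ANY statistic that detects `p ∣ h`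
  (`p ∣ h_K ⇒ p ≤ t(d_K)`; e.g. `t(D) = #Cl(K_D)[p]`, or `1 +` the number of reduced primitive norm-form triples of
  crux idea `order-p-triples-margin`). If, for infinitely many `X`, the SUM of `t` over the odd Heegner family of level
  `N` below `X` (negative fundamental `D ≡ 1 (mod 4)`, every prime factor of `N` split — the family of
  `…InertBadAtThreeNonNullOddHeegner`, which contains the progression `D ≡ 1 (mod 8N)` and so has positive lower
  density) is `≤ M · #family` with a constant `M < p`, then C⁺(N,p) holds. Proof: `∑ t ≥ p · #{t ≥ p}` gives
  `#{p ∤ h} ≥ (1 − M/p) · #family` at those `X`; the members sit in the C⁺ counting set (`|D| ≥ 7`); the reference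
  count is `≤ 2X + 1`; so the density ratio is `≥ c > 0` frequently and cannot tend to `0`.
* `nonNullIndivisibleHeegner_of_frequently_moment_le` — the same with the conclusion spelled as the registered stub's
  body at `(N, p)`.

Why it is the right currency: Cohen–Lenstra's first-moment heuristic predicts `avg #Cl(d)[p] → 2` over imaginary
quadratic fields for EVERY odd prime `p` (proved only at `p = 3`: Davenport–Heilbronn / Bhargava–Varma, the input of
`…InertBadAtThreeNonNullOddHeegner`); C⁺(N,p) for `p ≥ 5` needs far less — ANY bound `M < p` (so `M < 5` suffices for
every corner prime), along ANY unbounded sequence of `X`, for ANY majorant statistic. The printed pointwise / average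
`ℓ`-torsion bounds (Ellenberg–Venkatesh, Heath-Brown–Pierce, Frei–Widmer) are powers of `X`, not constants, so the
moment input stays OPEN for `p ≥ 5`; this file only makes the reduction kernel-exact. BSD is not proved by any of this;
21381 is not closed by this file.
-/

noncomputable section

open scoped Classical
open Finset Filter Topology
open Literature.NumberTheory.QuadraticFields Literature.NumberTheory.EllipticCurves
open Summit.BirchSwinnertonDyer.BirchSwinnertonDyer.Theorems.InertBadSignedBranchesInertBadAtThreeNonNullOddHeegner

namespace Summit.BirchSwinnertonDyer.BirchSwinnertonDyer.Theorems.BiquadraticEisensteinDescentHeegnerTwistCouplingInSupplyNonNullOfMoment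

/-- **Markov step.** For a finite family `Q` and a statistic `t : ℤ → ℕ`, `p · (#Q − #{D ∈ Q : t D < p}) ≤ Σ_Q t`.
[folklore] -/
theorem mul_card_sub_card_filter_lt_le_sum (Q : Finset ℤ) (t : ℤ → ℕ) (p : ℕ) :
    (p : ℝ) * ((Q.card : ℝ) - ((Q.filter fun D => t D < p).card : ℝ)) ≤ ∑ D ∈ Q, (t D : ℝ) := by
  have hsplit := Finset.card_filter_add_card_filter_not (s := Q) (fun D => t D < p)
  have hge : (p : ℝ) * ((Q.filter fun D => ¬ t D < p).card : ℝ) ≤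
      ∑ D ∈ Q.filter (fun D => ¬ t D < p), (t D : ℝ) := by
    rw [← nsmul_eq_mul', ← Finset.sum_const]
    · refine Finset.sum_le_sum fun D hD => ?_
      rw [Finset.mem_filter] at hD
      exact_mod_cast not_lt.mp hD.2
  have hle : ∑ D ∈ Q.filter (fun D => ¬ t D < p), (t D : ℝ) ≤ ∑ D ∈ Q, (t D : ℝ) :=
    Finset.sum_le_sum_of_subset_of_nonneg (Finset.filter_subset _ _) fun _ _ _ => Nat.cast_nonneg _
  have hcard : ((Q.filter fun D => ¬ t D < p).card : ℝ) =
      (Q.card : ℝ) - ((Q.filter fun D => t D < p).card : ℝ) := by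
    have h : (((Q.filter fun D => t D < p).card + (Q.filter fun D => ¬ t D < p).card : ℕ) : ℝ) =
        (Q.card : ℝ) := by exact_mod_cast hsplit
    push_cast at h
    linarith
  rw [← hcard]
  exact hge.trans hle

/-- The members of the odd Heegner family of level `N` on which the statistic is `< p` lie in the C⁺ counting set
`{d squarefree : |d| ≤ X, ∃ K imaginary quadratic, d_K = d, |d| > 4, Heegner for N, p ∤ h_K}` (odd negative
fundamental `D` has `D ≤ -7` or `D = -3`; `p ∣ h_K ⇒ p ≤ t(d_K)`). [folklore] -/
theorem card_erase_le_natCard_cplusSet (N X p : ℕ) (t : ℤ → ℕ)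
    (ht : ∀ (D : ℤ) (K : Type) [Field K] [NumberField K], IsImaginaryQuadratic K →
      NumberField.discr K = D → p ∣ NumberField.classNumber K → p ≤ t D) :
    ((((negFundDiscrs X).filter (fun D => Odd D ∧ ∃ (K : Type) (_ : Field K) (_ : NumberField K),
        IsImaginaryQuadratic K ∧ NumberField.discr K = D ∧ SatisfiesHeegnerHypothesis N K)).filter
        (fun D => t D < p)).erase (-3)).card ≤
      Nat.card {d : ℤ | Squarefree d ∧ |d| ≤ (X : ℤ) ∧
        ∃ (K : Type) (_ : Field K) (_ : NumberField K), IsImaginaryQuadratic K ∧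
          NumberField.discr K = d ∧ 4 < d.natAbs ∧ SatisfiesHeegnerHypothesis N K ∧
          ¬ p ∣ NumberField.classNumber K} := by
  set U := ((((negFundDiscrs X).filter (fun D => Odd D ∧ ∃ (K : Type) (_ : Field K) (_ : NumberField K),
        IsImaginaryQuadratic K ∧ NumberField.discr K = D ∧ SatisfiesHeegnerHypothesis N K)).filter
        (fun D => t D < p)).erase (-3)) with hU
  have hsub : (↑U : Set ℤ) ⊆ {d : ℤ | Squarefree d ∧ |d| ≤ (X : ℤ) ∧
        ∃ (K : Type) (_ : Field K) (_ : NumberField K), IsImaginaryQuadratic K ∧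
          NumberField.discr K = d ∧ 4 < d.natAbs ∧ SatisfiesHeegnerHypothesis N K ∧
          ¬ p ∣ NumberField.classNumber K} := by
    intro D hD
    rw [Finset.mem_coe, hU, Finset.mem_erase, Finset.mem_filter, Finset.mem_filter,
      mem_negFundDiscrs] at hD
    obtain ⟨hD3, ⟨⟨⟨hDX, hD0⟩, hfund⟩, hodd, K, iF, iN, hK, hdisc, hH⟩, htp⟩ := hD
    have hsq4 : D % 4 = 1 ∧ Squarefree D := by
      rcases hfund with ⟨h4, hsq, -⟩ | ⟨h4dvd, -, -⟩
      · exact ⟨h4, hsq⟩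
      · exfalso
        rw [Int.odd_iff] at hodd
        omega
    refine ⟨hsq4.2, abs_le.mpr ⟨by omega, by omega⟩, K, iF, iN, hK, hdisc, by omega, hH, ?_⟩
    intro hpdvd
    exact absurd (ht D K hK hdisc hpdvd) (not_le.mpr htp)
  have h := Nat.card_mono (finite_setOf_squarefree_abs_le X _) hsub
  rwa [Nat.card_coe_set_eq, Set.ncard_coe_finset] at h

/-- **C⁺(N,p) from a first-moment bound (frequently).** Let `N ≠ 0`, `p ≥ 1`, and `t : ℤ → ℕ` detect `p ∣ h`
(`p ∣ h_K ⇒ p ≤ t(d_K)`). If for infinitely many `X` the sum of `t` over the odd Heegner family of level `N` below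
`X` is at most `M · #family` with `M < p`, then the Heegner discriminants with `p ∤ h` are not a `twistDensity`-null
set. [folklore] -/
theorem not_twistDensity_zero_of_frequently_moment_le {N p : ℕ} (hN : N ≠ 0) (hp : 0 < p) (t : ℤ → ℕ)
    (ht : ∀ (D : ℤ) (K : Type) [Field K] [NumberField K], IsImaginaryQuadratic K →
      NumberField.discr K = D → p ∣ NumberField.classNumber K → p ≤ t D)
    {M : ℝ} (hM : M < p)
    (hmean : ∃ᶠ X : ℕ in atTop,
      (∑ D ∈ (negFundDiscrs X).filter (fun D => Odd D ∧ ∃ (K : Type) (_ : Field K) (_ : NumberField K),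
          IsImaginaryQuadratic K ∧ NumberField.discr K = D ∧ SatisfiesHeegnerHypothesis N K), (t D : ℝ)) ≤
        M * (((negFundDiscrs X).filter (fun D => Odd D ∧ ∃ (K : Type) (_ : Field K) (_ : NumberField K),
          IsImaginaryQuadratic K ∧ NumberField.discr K = D ∧ SatisfiesHeegnerHypothesis N K)).card : ℝ)) :
    ¬ twistDensity (fun d : ℤ ↦ ∃ (K : Type) (_ : Field K) (_ : NumberField K),
        IsImaginaryQuadratic K ∧ NumberField.discr K = d ∧ 4 < d.natAbs ∧
        SatisfiesHeegnerHypothesis N K ∧ ¬ p ∣ NumberField.classNumber K) 0 := by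
  intro hT
  set Q : ℕ → Finset ℤ := fun X => (negFundDiscrs X).filter (fun D => Odd D ∧
      ∃ (K : Type) (_ : Field K) (_ : NumberField K),
        IsImaginaryQuadratic K ∧ NumberField.discr K = D ∧ SatisfiesHeegnerHypothesis N K) with hQ
  set T : ℕ → Finset ℤ := fun X => (Ico (-(X : ℤ) + 1) 0).filter
      (fun x => x ≡ 1 [ZMOD ((8 * N : ℕ) : ℤ)] ∧ Squarefree x) with hTdef
  set G : ℕ → Finset ℤ := fun X => (Q X).filter (fun D => t D < p) with hG
  set Num : ℕ → ℝ := fun X => (Nat.card {d : ℤ | Squarefree d ∧ |d| ≤ (X : ℤ) ∧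
      ∃ (K : Type) (_ : Field K) (_ : NumberField K), IsImaginaryQuadratic K ∧
        NumberField.discr K = d ∧ 4 < d.natAbs ∧ SatisfiesHeegnerHypothesis N K ∧
        ¬ p ∣ NumberField.classNumber K} : ℝ) with hNum
  set Den : ℕ → ℝ := fun X => (Nat.card {d : ℤ | Squarefree d ∧ |d| ≤ (X : ℤ)} : ℝ) with hDen
  -- the margin `κ = 1 - M/p > 0` (if `M < 0` the family is eventually empty-summed; the argument still runs with κ ≥ 1)
  have hp0 : (0 : ℝ) < p := by exact_mod_cast hp
  set κ : ℝ := 1 - M / p with hκ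
  have hκ0 : 0 < κ := by
    rw [hκ, sub_pos, div_lt_one hp0]
    exact hM
  -- §2 of the three-torsion file: the progression count `T X / X → c > 0`
  obtain ⟨c, hc0, hTc⟩ := exists_pos_tendsto_card_progression_div hN
  -- comparison function `(κ · T X - 1) / (2X + 1) → κ c / 2`
  have hcmp : Tendsto (fun X : ℕ => (κ * ((T X).card : ℝ) - 1) / (2 * X + 1)) atTop (𝓝 (κ * c / 2)) := by
    have h1 : Tendsto (fun X : ℕ => (1 : ℝ) / X) atTop (𝓝 0) :=
      tendsto_const_nhds.div_atTop tendsto_natCast_atTop_atTop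
    have hnum : Tendsto (fun X : ℕ => κ * (((T X).card : ℝ) / X) - 1 / X) atTop (𝓝 (κ * c - 0)) :=
      (hTc.const_mul κ).sub h1
    have hden : Tendsto (fun X : ℕ => (2 : ℝ) + 1 / X) atTop (𝓝 (2 + 0)) :=
      tendsto_const_nhds.add h1
    have hq := hnum.div hden (by norm_num)
    rw [sub_zero, add_zero] at hq
    refine hq.congr' ?_
    filter_upwards [eventually_gt_atTop 0] with X hX
    have hX0 : (X : ℝ) ≠ 0 := by positivity
    simp only [Pi.div_apply]
    field_simp
  have hev1 : ∀ᶠ X : ℕ in atTop, κ * c / 4 < (κ * ((T X).card : ℝ) - 1) / (2 * X + 1) :=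
    (tendsto_order.1 hcmp).1 _ (by nlinarith)
  have hev3 : ∀ᶠ X : ℕ in atTop, Num X / Den X < κ * c / 4 :=
    (tendsto_order.1 hT).2 _ (by positivity)
  -- pick `X ≥ 1` where the moment bound holds together with the two eventual facts
  obtain ⟨X, hmX, hX1, h1, h3⟩ :=
    (hmean.and_eventually ((eventually_ge_atTop 1).and (hev1.and hev3))).exists
  have hX0 : (0 : ℝ) < 2 * X + 1 := by positivity
  have hTQ : ((T X).card : ℝ) ≤ ((Q X).card : ℝ) := by
    exact_mod_cast card_progression_le_card_heegnerOddFamily N X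
  -- Markov: `#G ≥ κ · #Q`
  have hGQ : κ * ((Q X).card : ℝ) ≤ ((G X).card : ℝ) := by
    have hS := mul_card_sub_card_filter_lt_le_sum (Q X) t p
    change (p : ℝ) * (((Q X).card : ℝ) - ((G X).card : ℝ)) ≤ _ at hS
    change (∑ D ∈ Q X, (t D : ℝ)) ≤ M * ((Q X).card : ℝ) at hmX
    have h := hS.trans hmX
    -- `p (#Q - #G) ≤ M #Q` ⇒ `#G ≥ (1 - M/p) #Q`
    rw [hκ, sub_mul, one_mul, div_mul_eq_mul_div, sub_le_iff_le_add]
    rw [mul_sub] at h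
    have hQ0 : (0 : ℝ) ≤ (Q X).card := Nat.cast_nonneg _
    have : (p : ℝ) * ((Q X).card : ℝ) - M * ((Q X).card : ℝ) ≤ (p : ℝ) * ((G X).card : ℝ) := by linarith
    have h' : ((Q X).card : ℝ) - M * ((Q X).card : ℝ) / p ≤ ((G X).card : ℝ) := by
      rw [sub_le_iff_le_add]
      have := div_le_div_of_nonneg_right this hp0.le
      rw [mul_comm (p : ℝ) ((G X).card : ℝ), mul_div_assoc, div_self hp0.ne', mul_one, sub_div,
        mul_comm (p : ℝ), mul_div_assoc, div_self hp0.ne', mul_one] at this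
      linarith
    linarith
  -- numerator `≥ #G - 1`
  have hNumG : ((G X).card : ℝ) - 1 ≤ Num X := by
    have h := card_erase_le_natCard_cplusSet N X p t ht
    have h' : (G X).card - 1 ≤ ((G X).erase (-3)).card := Finset.pred_card_le_card_erase
    have h'' : (G X).card ≤ Nat.card {d : ℤ | Squarefree d ∧ |d| ≤ (X : ℤ) ∧
        ∃ (K : Type) (_ : Field K) (_ : NumberField K), IsImaginaryQuadratic K ∧
          NumberField.discr K = d ∧ 4 < d.natAbs ∧ SatisfiesHeegnerHypothesis N K ∧
          ¬ p ∣ NumberField.classNumber K} + 1 := by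
      change ((G X).erase (-3)).card ≤ _ at h
      omega
    have : ((G X).card : ℝ) ≤ Num X + 1 := by
      simp only [hNum]
      exact_mod_cast h''
    linarith
  have hDenle : Den X ≤ 2 * X + 1 := natCard_squarefree_abs_le_le X
  have hDenpos : 0 < Den X := by
    simp only [hDen]
    exact_mod_cast natCard_squarefree_abs_le_pos hX1
  have hNum0 : 0 ≤ Num X := Nat.cast_nonneg _
  have hchain : κ * c / 4 < Num X / Den X :=
    calc κ * c / 4 < (κ * ((T X).card : ℝ) - 1) / (2 * X + 1) := h1
      _ ≤ (κ * ((Q X).card : ℝ) - 1) / (2 * X + 1) := by gcongr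
      _ ≤ (((G X).card : ℝ) - 1) / (2 * X + 1) := by gcongr
      _ ≤ Num X / (2 * X + 1) := by gcongr
      _ ≤ Num X / Den X := div_le_div_of_nonneg_left hNum0 hDenpos hDenle
  exact absurd h3 (not_lt.mpr hchain.le)

/-- **The registered stub's body at `(N, p)` from a first-moment bound** — the conclusion is literally the body of
`stub_nonNullIndivisibleHeegner` (line `size_tail`, crux 21381) at `N`, `p`; the binder `5 ≤ p` of the stub is not
needed for the bridge (only `M < p`). [folklore] -/
theorem nonNullIndivisibleHeegner_of_frequently_moment_le (N p : ℕ) (hN : N ≠ 0) (hp : p.Prime) (t : ℤ → ℕ)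
    (ht : ∀ (D : ℤ) (K : Type) [Field K] [NumberField K], IsImaginaryQuadratic K →
      NumberField.discr K = D → p ∣ NumberField.classNumber K → p ≤ t D)
    (M : ℝ) (hM : M < p)
    (hmean : ∃ᶠ X : ℕ in atTop,
      (∑ D ∈ (negFundDiscrs X).filter (fun D => Odd D ∧ ∃ (K : Type) (_ : Field K) (_ : NumberField K),
          IsImaginaryQuadratic K ∧ NumberField.discr K = D ∧ SatisfiesHeegnerHypothesis N K), (t D : ℝ)) ≤
        M * (((negFundDiscrs X).filter (fun D => Odd D ∧ ∃ (K : Type) (_ : Field K) (_ : NumberField K),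
          IsImaginaryQuadratic K ∧ NumberField.discr K = D ∧ SatisfiesHeegnerHypothesis N K)).card : ℝ)) :
    ¬ twistDensity (fun d : ℤ ↦ ∃ (K : Type) (_ : Field K) (_ : NumberField K),
        IsImaginaryQuadratic K ∧ NumberField.discr K = d ∧ 4 < d.natAbs ∧
        SatisfiesHeegnerHypothesis N K ∧ ¬ p ∣ NumberField.classNumber K) 0 :=
  not_twistDensity_zero_of_frequently_moment_le hN hp.pos t ht hM hmean

end Summit.BirchSwinnertonDyer.BirchSwinnertonDyer.Theorems.BiquadraticEisensteinDescentHeegnerTwistCouplingInSupplyNonNullOfMoment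

end
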